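import Summits.AnomalousDissipation.AnomalousDissipation.Theorems.MarginalStabilityChainStrainedLayerLawStubStrainWorkIdentityA
import Mathlib.Analysis.Calculus.FDeriv.Symmetric
import HarnessLib

/-!
# Stub `stub_excessEnergyKinematic` of line `strain-work-sum-rule` (crux `MarginalStabilityChain.StrainedLayerLaw`,
# stmt-AnomalousDissipation-3007) — tool file B: enstrophy equals the Dirichlet integral

Support file (`--supports stmt-AnomalousDissipation-3007`; registered sub-goal
`stub_excessEnergyKinematic_enstrophy`). For one divergence-free `C²` slice `(u, v)` of the shear-layer class,
`L`-periodic in `x`, with shear tails `SliceTails C k u v` (`k > 0`), the Dirichlet integral over the period strip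
equals the enstrophy:

  `∫∫_{(0,L]×ℝ} |∇(u, v)|² = ∫∫_{(0,L]×ℝ} ω²`,  `ω = ∂ₓv − ∂_yu`

(Majda–Bertozzi 2002, §3.1.1, eq. (3.6)–(3.8): `‖∇v‖₀ = ‖ω‖₀` for divergence-free fields; here on the period
strip with a non-decaying background). Proof: mixed partials of `C²` fields commute (`dX_dY_comm`), so
`Δu = −∂_yω` and `Δv = ∂ₓω` for a divergence-free pair; by the viscous equality on the strip
(`stub_strainWorkIdentity_viscous`, tool file A of `stub_strainWorkIdentity`) `∫∫|∇u|² = −∫∫uΔu = ∫∫u∂_yω`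
and `∫∫|∇v|² = −∫∫v∂ₓω`, and one integration by parts each (in `y` with integrable products, in `x` by
periodicity) gives `−∫∫∂_yu·ω + ∫∫∂ₓv·ω = ∫∫ω²`.

References: A. J. Majda, A. L. Bertozzi, *Vorticity and Incompressible Flow*, CUP 2002, §3.1.1.
-/

-- `Summit.<Summit>.<Problem>` is the tree's mandated summit-side namespace (CONVENTIONS §2); for this
-- single-conjunct summit the two coincide, so the duplicate is deliberate.
set_option linter.dupNamespace false

noncomputable section

open scoped Topology ENNReal
open Filter Set Function MeasureTheory

namespace Summit.AnomalousDissipation.AnomalousDissipation.Theorems.StrainedLayerLaw.StrainWorkSumRule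

open Literature.Analysis.FluidPDE Literature.Analysis.FluidPDE.StretchedLayer

/-! ## Mixed partials commute; Laplacians of a divergence-free pair -/

/-- **Mixed slice partials of a jointly `C²` plane field commute**: `∂ₓ∂_yf = ∂_y∂ₓf` (symmetry of the second
Fréchet derivative, Mathlib's `ContDiffAt.isSymmSndFDerivAt`). [folklore] -/
theorem dX_dY_comm {f : ℝ → ℝ → ℝ} (hf : ContDiff ℝ 2 (fun q : ℝ × ℝ => f q.1 q.2)) (x y : ℝ) :
    dX (dY f) x y = dY (dX f) x y := by
  -- adapted from `…Theorems.MarginalStabilityChainStretchedVortexRows.PressureTools.dX_dY_comm`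
  set F : ℝ × ℝ → ℝ := fun q => f q.1 q.2 with hF
  set D : ℝ × ℝ → (ℝ × ℝ →L[ℝ] ℝ) := fderiv ℝ F with hD
  have hd : Differentiable ℝ F := hf.differentiable (by simp)
  have hDc : ContDiff ℝ 1 D := hf.fderiv_right (by norm_num)
  have hDd : Differentiable ℝ D := hDc.differentiable (by simp)
  have hY : ∀ a b, dY f a b = D (a, b) (0, 1) := fun a b => dY_eq_fderiv (hd (a, b))
  have hX : ∀ a b, dX f a b = D (a, b) (1, 0) := fun a b => dX_eq_fderiv (hd (a, b))
  have h1 : HasDerivAt (fun s => D (s, y) ((0 : ℝ), (1 : ℝ)))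
      (fderiv ℝ D (x, y) ((1 : ℝ), (0 : ℝ)) ((0 : ℝ), (1 : ℝ))) x := by
    have hl : HasDerivAt (fun s : ℝ => (s, y)) ((1 : ℝ), (0 : ℝ)) x :=
      (hasDerivAt_id x).prodMk (hasDerivAt_const x y)
    have hc : HasDerivAt (fun s => D (s, y)) (fderiv ℝ D (x, y) ((1 : ℝ), (0 : ℝ))) x :=
      (hDd (x, y)).hasFDerivAt.comp_hasDerivAt x hl
    exact ((ContinuousLinearMap.apply ℝ ℝ (((0 : ℝ), (1 : ℝ)) : ℝ × ℝ)).hasFDerivAt.comp_hasDerivAt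
      x hc :)
  have h2 : HasDerivAt (fun s => D (x, s) ((1 : ℝ), (0 : ℝ)))
      (fderiv ℝ D (x, y) ((0 : ℝ), (1 : ℝ)) ((1 : ℝ), (0 : ℝ))) y := by
    have hl : HasDerivAt (fun s : ℝ => (x, s)) ((0 : ℝ), (1 : ℝ)) y :=
      (hasDerivAt_const y x).prodMk (hasDerivAt_id y)
    have hc : HasDerivAt (fun s => D (x, s)) (fderiv ℝ D (x, y) ((0 : ℝ), (1 : ℝ))) y :=
      (hDd (x, y)).hasFDerivAt.comp_hasDerivAt y hl
    exact ((ContinuousLinearMap.apply ℝ ℝ (((1 : ℝ), (0 : ℝ)) : ℝ × ℝ)).hasFDerivAt.comp_hasDerivAt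
      y hc :)
  have e1 : dX (dY f) x y = fderiv ℝ D (x, y) ((1 : ℝ), (0 : ℝ)) ((0 : ℝ), (1 : ℝ)) := by
    have hfun : (fun s => dY f s y) = fun s => D (s, y) ((0 : ℝ), (1 : ℝ)) := funext fun s => hY s y
    rw [dX, hfun]
    exact h1.deriv
  have e2 : dY (dX f) x y = fderiv ℝ D (x, y) ((0 : ℝ), (1 : ℝ)) ((1 : ℝ), (0 : ℝ)) := by
    have hfun : (fun s => dX f x s) = fun s => D (x, s) ((1 : ℝ), (0 : ℝ)) := funext fun s => hX x s
    rw [dY, hfun]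
    exact h2.deriv
  have hsymm : IsSymmSndFDerivAt ℝ F (x, y) :=
    (hf.contDiffAt (x := (x, y))).isSymmSndFDerivAt (by simp)
  rw [e1, e2]
  exact hsymm _ _

variable {u v : ℝ → ℝ → ℝ}

/-- The vorticity of a `C²` pair is `C¹`. [folklore] -/
theorem contDiff_one_vorticity (hu : ContDiff ℝ 2 (fun q : ℝ × ℝ => u q.1 q.2))
    (hv : ContDiff ℝ 2 (fun q : ℝ × ℝ => v q.1 q.2)) :
    ContDiff ℝ 1 (fun q : ℝ × ℝ => vorticity u v q.1 q.2) := by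
  unfold vorticity
  exact (contDiff_one_dX hv).sub (contDiff_one_dY hu)

/-- For a divergence-free `C²` pair, `Δu = −∂_yω`: `∂_yω = ∂_y∂ₓv − ∂_y∂_yu = ∂ₓ∂_yv − ∂_y∂_yu = −∂ₓ∂ₓu − ∂_y∂_yu`
(Schwarz for `v` and `∂ₓ` of `∂ₓu + ∂_yv = 0`). [folklore] -/
theorem lap_eq_neg_dY_vorticity (hu : ContDiff ℝ 2 (fun q : ℝ × ℝ => u q.1 q.2))
    (hv : ContDiff ℝ 2 (fun q : ℝ × ℝ => v q.1 q.2)) (hdiv : ∀ x y, dX u x y + dY v x y = 0) (x y : ℝ) :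
    lap u x y = -dY (vorticity u v) x y := by
  have h1 : dY (vorticity u v) x y = dY (dX v) x y - dY (dY u) x y := by
    show dY (fun a b => dX v a b - dY u a b) x y = _
    exact dY_sub (hasDerivAt_dY_of_contDiff (contDiff_one_dX hv) one_ne_zero x y).differentiableAt
      (hasDerivAt_dY_of_contDiff (contDiff_one_dY hu) one_ne_zero x y).differentiableAt
  have h2 : dX (dX u) x y + dX (dY v) x y = 0 := by
    have hd := (hasDerivAt_dX_of_contDiff (contDiff_one_dX hu) one_ne_zero x y).fun_add
      (hasDerivAt_dX_of_contDiff (contDiff_one_dY hv) one_ne_zero x y)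
    have e : (fun s => dX u s y + dY v s y) = fun _ => (0 : ℝ) := funext fun s => hdiv s y
    rw [e] at hd
    exact hd.unique (hasDerivAt_const x 0)
  rw [lap_apply, h1, ← dX_dY_comm hv x y]
  linarith

/-- For a divergence-free `C²` pair, `Δv = ∂ₓω`: `∂ₓω = ∂ₓ∂ₓv − ∂ₓ∂_yu = ∂ₓ∂ₓv − ∂_y∂ₓu = ∂ₓ∂ₓv + ∂_y∂_yv`
(Schwarz for `u` and `∂_y` of `∂ₓu + ∂_yv = 0`). [folklore] -/
theorem lap_eq_dX_vorticity (hu : ContDiff ℝ 2 (fun q : ℝ × ℝ => u q.1 q.2))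
    (hv : ContDiff ℝ 2 (fun q : ℝ × ℝ => v q.1 q.2)) (hdiv : ∀ x y, dX u x y + dY v x y = 0) (x y : ℝ) :
    lap v x y = dX (vorticity u v) x y := by
  have h1 : dX (vorticity u v) x y = dX (dX v) x y - dX (dY u) x y := by
    show dX (fun a b => dX v a b - dY u a b) x y = _
    exact dX_sub (hasDerivAt_dX_of_contDiff (contDiff_one_dX hv) one_ne_zero x y).differentiableAt
      (hasDerivAt_dX_of_contDiff (contDiff_one_dY hu) one_ne_zero x y).differentiableAt
  have h2 : dY (dX u) x y + dY (dY v) x y = 0 := by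
    have hd := (hasDerivAt_dY_of_contDiff (contDiff_one_dX hu) one_ne_zero x y).fun_add
      (hasDerivAt_dY_of_contDiff (contDiff_one_dY hv) one_ne_zero x y)
    have e : (fun s => dX u x s + dY v x s) = fun _ => (0 : ℝ) := funext fun s => hdiv x s
    rw [e] at hd
    exact hd.unique (hasDerivAt_const y 0)
  rw [lap_apply, h1, dX_dY_comm hu x y]
  linarith

/-! ## Enstrophy equals the Dirichlet integral on the period strip -/

/-- **Enstrophy equals the Dirichlet integral** (registered sub-goal `stub_excessEnergyKinematic_enstrophy`). For a
divergence-free `C²` pair `(u, v)`, `L`-periodic in `x` (`L > 0`), with shear tails `SliceTails C k u v`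
(`k > 0`): `ω²` and `|∇(u,v)|²` are integrable on the period strip `(0, L] × ℝ` and
`∫∫ |∇(u,v)|² = ∫∫ ω²` (Majda–Bertozzi 2002, §3.1.1, (3.6)–(3.8), on the period strip): `Δu = −∂_yω`,
`Δv = ∂ₓω`, the viscous equality `∫∫ fΔf = −∫∫|∇f|²` for `f = u, v`, and one integration by parts each.
[folklore] -/
theorem stub_excessEnergyKinematic_enstrophy : ∀ (L C k : ℝ), 0 < L → 0 < k → ∀ (u v : ℝ → ℝ → ℝ),
    ContDiff ℝ 2 (fun q : ℝ × ℝ => u q.1 q.2) → ContDiff ℝ 2 (fun q : ℝ × ℝ => v q.1 q.2) →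
    (∀ x y, dX u x y + dY v x y = 0) →
    (∀ x y, u (x + L) y = u x y) → (∀ x y, v (x + L) y = v x y) →
    SliceTails C k u v →
      IntegrableOn (fun q : ℝ × ℝ => vorticity u v q.1 q.2 ^ 2) (Ioc 0 L ×ˢ univ) ∧
      IntegrableOn (fun q : ℝ × ℝ => dX u q.1 q.2 ^ 2 + dY u q.1 q.2 ^ 2 + dX v q.1 q.2 ^ 2 +
        dY v q.1 q.2 ^ 2) (Ioc 0 L ×ˢ univ) ∧
      ∫ q in Ioc 0 L ×ˢ univ, (dX u q.1 q.2 ^ 2 + dY u q.1 q.2 ^ 2 + dX v q.1 q.2 ^ 2 + dY v q.1 q.2 ^ 2) =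
        ∫ q in Ioc 0 L ×ˢ univ, vorticity u v q.1 q.2 ^ 2 := by
  intro L C k hL hk u v hu hv hdiv hpu hpv hT
  have hS : MeasurableSet (Ioc (0:ℝ) L ×ˢ (univ : Set ℝ)) := measurableSet_Ioc.prod MeasurableSet.univ
  have hC : 0 ≤ C := hT.nonneg
  have he1 : ∀ y : ℝ, Real.exp (-k * |y|) ≤ 1 := exp_neg_mul_abs_le_one hk
  -- regularity
  have hu1 : ContDiff ℝ 1 (fun q : ℝ × ℝ => u q.1 q.2) := hu.of_le one_le_two
  have hv1 : ContDiff ℝ 1 (fun q : ℝ × ℝ => v q.1 q.2) := hv.of_le one_le_two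
  have hω1 := contDiff_one_vorticity hu hv
  have cu : Continuous (fun q : ℝ × ℝ => u q.1 q.2) := hu.continuous
  have cv : Continuous (fun q : ℝ × ℝ => v q.1 q.2) := hv.continuous
  have cω : Continuous (fun q : ℝ × ℝ => vorticity u v q.1 q.2) := hω1.continuous
  have cuy := continuous_dY hu1
  have cvx := continuous_dX hv1
  have cωx := continuous_dX hω1
  -- pointwise bounds
  have huB : ∀ x y, |u x y| ≤ 1 + C := hT.abs_u_le hk
  have hvB : ∀ x y, |v x y| ≤ C := hT.abs_v_le_const hk
  have hωe : ∀ x y, |vorticity u v x y| ≤ C * Real.exp (-k * |y|) := fun x y => by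
    have h := (hT x y).2.2.1
    calc |vorticity u v x y| = |dX v x y - dY u x y| := rfl
      _ ≤ |dX v x y| + |dY u x y| := abs_sub _ _
      _ ≤ C * Real.exp (-k * |y|) := by linarith [abs_nonneg (dX u x y), abs_nonneg (dY v x y)]
  have huyC : ∀ x y, |dY u x y| ≤ C := fun x y =>
    (hT.abs_dY_u_le x y).trans (mul_le_of_le_one_right hC (he1 y))
  have hvxC : ∀ x y, |dX v x y| ≤ C := fun x y =>
    (hT.abs_dX_v_le x y).trans (mul_le_of_le_one_right hC (he1 y))
  have hωC : ∀ x y, |vorticity u v x y| ≤ C := fun x y =>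
    (hωe x y).trans (mul_le_of_le_one_right hC (he1 y))
  -- the viscous equalities for `u` and `v`
  obtain ⟨iUl, iUg, hUeq⟩ := stub_strainWorkIdentity_viscous L k (1 + C) C u hL hk hu hpu huB
    hT.abs_grad_u_le hT.abs_lap_u_le
  obtain ⟨iVl, iVg, hVeq⟩ := stub_strainWorkIdentity_viscous L k C C v hL hk hv hpv hvB
    hT.abs_grad_v_le hT.abs_lap_v_le
  have hlapu : ∀ x y, lap u x y = -dY (vorticity u v) x y := lap_eq_neg_dY_vorticity hu hv hdiv
  have hlapv : ∀ x y, lap v x y = dX (vorticity u v) x y := lap_eq_dX_vorticity hu hv hdiv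
  -- integrability of the products on the strip
  have bnd : ∀ {a b A : ℝ} (y : ℝ), |a| ≤ A → |b| ≤ C * Real.exp (-k * |y|) →
      |a * b| ≤ A * C * Real.exp (-k * |y|) := by
    intro a b A y ha hb
    rw [abs_mul, mul_assoc]
    exact mul_le_mul ha hb (abs_nonneg _) ((abs_nonneg _).trans ha)
  have iωu : IntegrableOn (fun q : ℝ × ℝ => dY u q.1 q.2 * vorticity u v q.1 q.2) (Ioc 0 L ×ˢ univ) :=
    integrableOn_strip_of_abs_le_exp (cuy.mul cω) (mul_nonneg hC hC) hk fun x _ y => bnd y (huyC x y) (hωe x y)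
  have iuω : IntegrableOn (fun q : ℝ × ℝ => u q.1 q.2 * vorticity u v q.1 q.2) (Ioc 0 L ×ˢ univ) :=
    integrableOn_strip_of_abs_le_exp (cu.mul cω) (mul_nonneg (by linarith) hC) hk
      fun x _ y => bnd y (huB x y) (hωe x y)
  have iωv : IntegrableOn (fun q : ℝ × ℝ => dX v q.1 q.2 * vorticity u v q.1 q.2) (Ioc 0 L ×ˢ univ) :=
    integrableOn_strip_of_abs_le_exp (cvx.mul cω) (mul_nonneg hC hC) hk fun x _ y => bnd y (hvxC x y) (hωe x y)
  have iuωy : IntegrableOn (fun q : ℝ × ℝ => u q.1 q.2 * dY (vorticity u v) q.1 q.2) (Ioc 0 L ×ˢ univ) :=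
    iUl.neg.congr_fun (fun q _ => by simp only [Pi.neg_apply, hlapu]; ring) hS
  have ivωx : IntegrableOn (fun q : ℝ × ℝ => v q.1 q.2 * dX (vorticity u v) q.1 q.2) (Ioc 0 L ×ˢ univ) :=
    iVl.congr_fun (fun q _ => by simp only [hlapv]) hS
  have iω2 : IntegrableOn (fun q : ℝ × ℝ => vorticity u v q.1 q.2 ^ 2) (Ioc 0 L ×ˢ univ) :=
    integrableOn_strip_of_abs_le_exp (cω.pow 2) (mul_nonneg hC hC) hk fun x _ y => by
      rw [pow_two]; exact bnd y (hωC x y) (hωe x y)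
  -- integration by parts: in `y` for `∫∫ u ∂_yω`, in `x` for `∫∫ v ∂ₓω`
  have hIBPy : ∫ q in Ioc 0 L ×ˢ univ, u q.1 q.2 * dY (vorticity u v) q.1 q.2 =
      -∫ q in Ioc 0 L ×ˢ univ, dY u q.1 q.2 * vorticity u v q.1 q.2 :=
    integral_strip_mul_dY_eq_neg (hasDerivAt_dY_of_contDiff hu two_ne_zero)
      (hasDerivAt_dY_of_contDiff hω1 one_ne_zero) iuωy iωu iuω
  have hIBPx : ∫ q in Ioc 0 L ×ˢ univ, v q.1 q.2 * dX (vorticity u v) q.1 q.2 =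
      -∫ q in Ioc 0 L ×ˢ univ, dX v q.1 q.2 * vorticity u v q.1 q.2 := by
    refine integral_strip_mul_dX_eq_neg hL.le (hasDerivAt_dX_of_contDiff hv two_ne_zero)
      (hasDerivAt_dX_of_contDiff hω1 one_ne_zero) (continuous_slice_x cvx) (continuous_slice_x cωx)
      (fun y => ?_) ivωx iωv
    have hv0 : v L y = v 0 y := by simpa using hpv 0 y
    have hω0 : vorticity u v L y = vorticity u v 0 y := by
      show dX v L y - dY u L y = dX v 0 y - dY u 0 y
      rw [show dX v L y = dX v 0 y by simpa using dX_periodic hpv 0 y,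
        show dY u L y = dY u 0 y by simpa using dY_periodic hpu 0 y]
    rw [hv0, hω0]
  -- assemble
  refine ⟨iω2, (iUg.add iVg).congr_fun (fun q _ => by simp only [Pi.add_apply]; ring) hS, ?_⟩
  have e1 : ∫ q in Ioc 0 L ×ˢ univ, (dX u q.1 q.2 ^ 2 + dY u q.1 q.2 ^ 2 + dX v q.1 q.2 ^ 2 + dY v q.1 q.2 ^ 2) =
      (∫ q in Ioc 0 L ×ˢ univ, (dX u q.1 q.2 ^ 2 + dY u q.1 q.2 ^ 2)) +
        ∫ q in Ioc 0 L ×ˢ univ, (dX v q.1 q.2 ^ 2 + dY v q.1 q.2 ^ 2) := by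
    rw [← integral_add iUg iVg]
    exact integral_congr_ae (Eventually.of_forall fun q => by ring)
  have e2 : ∫ q in Ioc 0 L ×ˢ univ, u q.1 q.2 * lap u q.1 q.2 =
      -∫ q in Ioc 0 L ×ˢ univ, u q.1 q.2 * dY (vorticity u v) q.1 q.2 := by
    rw [← integral_neg]
    exact integral_congr_ae (Eventually.of_forall fun q => by simp only [hlapu]; ring)
  have e3 : ∫ q in Ioc 0 L ×ˢ univ, v q.1 q.2 * lap v q.1 q.2 =
      ∫ q in Ioc 0 L ×ˢ univ, v q.1 q.2 * dX (vorticity u v) q.1 q.2 :=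
    integral_congr_ae (Eventually.of_forall fun q => by simp only [hlapv])
  have e4 : ∫ q in Ioc 0 L ×ˢ univ, vorticity u v q.1 q.2 ^ 2 =
      (∫ q in Ioc 0 L ×ˢ univ, dX v q.1 q.2 * vorticity u v q.1 q.2) -
        ∫ q in Ioc 0 L ×ˢ univ, dY u q.1 q.2 * vorticity u v q.1 q.2 := by
    rw [← integral_sub iωv iωu]
    exact integral_congr_ae (Eventually.of_forall fun q => by
      show (dX v q.1 q.2 - dY u q.1 q.2) ^ 2 =
        dX v q.1 q.2 * (dX v q.1 q.2 - dY u q.1 q.2) - dY u q.1 q.2 * (dX v q.1 q.2 - dY u q.1 q.2)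
      ring)
  have hU : ∫ q in Ioc 0 L ×ˢ univ, (dX u q.1 q.2 ^ 2 + dY u q.1 q.2 ^ 2) =
      -∫ q in Ioc 0 L ×ˢ univ, dY u q.1 q.2 * vorticity u v q.1 q.2 := by
    have h := hUeq; rw [e2, hIBPy] at h; linarith
  have hV : ∫ q in Ioc 0 L ×ˢ univ, (dX v q.1 q.2 ^ 2 + dY v q.1 q.2 ^ 2) =
      ∫ q in Ioc 0 L ×ˢ univ, dX v q.1 q.2 * vorticity u v q.1 q.2 := by
    have h := hVeq; rw [e3, hIBPx] at h; linarith
  rw [e1, e4, hU, hV]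
  ring

end Summit.AnomalousDissipation.AnomalousDissipation.Theorems.StrainedLayerLaw.StrainWorkSumRule

end
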